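import Literature.Topology.FourManifolds.MorseChartReflect
import Literature.Topology.FourManifolds.OneHandleStep
import HarnessLib

/-!
# Rotating a Morse chart of index `1` by `π`: feet exchanged, orientation kept

Topic `Literature/Topology/FourManifolds` (fact seat
`provefact-Literature.Topology.FourManifolds.lauden-f709dd520c`, Laudenbach–Poénaru's Lemma 2, the
flip `H₂` of a `1`-handle: "`Φ₂(x₁) = x₁⁻¹`", p. 339, realised by a self-diffeomorphism of the
handlebody exchanging the two feet of the handle).  Everything here is **proved**; no named
facts.

`MorseChartReflect.lean` composes a Milnor chart of index `1` with the reflection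
`(u₀, y) ↦ (-u₀, y)`, which exchanges the feet but reverses the orientation — so that the
handle-extension step with that second chart can never satisfy the matching condition of the
two-disc theorem with a diffeotopy of the level (an isotopy preserves orientations).  Here the
chart is composed instead with the **rotation by `π`** `r(u₀, y₁, y') = (-u₀, -y₁, y')`
(`OneHandleModel.rotE`, for `n ≥ 1`; the conjugate under `consCLE` of
`(modelReflection, -1)`): a linear isometric involution preserving Milnor's `Q₁`, mapping the
chart balls onto themselves, with `r (footModel s m ρ w) = footModel (-s) m ρ (R₀ w)`, `R₀` the
reflection `modelReflection` of the parameter space `ℝⁿ` (`OneHandleStep.lean`).  The rest is a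
copy of `MorseChartReflect.lean`: the rotated chart `rotateChart φ p R₀` on
`φ.source ∩ φ̂⁻¹ B(φ̂ p, R₀)` is in the maximal atlas, has the same centre and the same normal
form for `f`, and **its feet are the feet of `φ` with the sign exchanged and the parameter
reflected** (`rotateChart_foot`).

## References

* J. Milnor, *Lectures on the h-cobordism theorem* (1965), Def. 3.1, proof of Thm. 3.13.
  [MilnorHCobordism1965]
* F. Laudenbach, V. Poénaru, Bull. Soc. Math. France 100 (1972), proof of Lemma 2 (pp. 339–340).
  [LaudenbachPoenaruBSMF1972]
* A. A. Kosinski, *Differential Manifolds* (1993), VI (6.6). [Kosinski1993]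
-/

open scoped Manifold ContDiff Topology
open Set Function Module Metric

noncomputable section

namespace Literature.Topology.FourManifolds

universe u

/-- Local notation: `𝔼 n` is the model Euclidean space `EuclideanSpace ℝ (Fin n)`. -/
local notation "𝔼 " n:arg => EuclideanSpace ℝ (Fin n)
/-- Local notation: `ℍ n` is the model half-space `EuclideanHalfSpace n`. -/
local notation "ℍ " n:arg => EuclideanHalfSpace n

open BoundaryManifold

/-! ### The rotation by `π` in the `(u₀, y₁)`-plane -/

namespace OneHandleModel

variable {n : ℕ} (hn : 1 ≤ n)

/-- **The rotation by `π`** `(u₀, y₁, y') ↦ (-u₀, -y₁, y')` of `ℝⁿ⁺¹` (`n ≥ 1`): in the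
coordinates `u = consCLE (y, u₀)`, `(y, u₀) ↦ (R₀ y, -u₀)` with `R₀ = modelReflection`. [folklore] -/
def rotE : 𝔼 (n + 1) ≃L[ℝ] 𝔼 (n + 1) :=
  (consCLE n).symm.trans ((((modelReflection hn).toContinuousLinearEquiv).prodCongr (ContinuousLinearEquiv.neg ℝ)).trans (consCLE n))

/-- The rotation on `consCLE (y, t)`: `(y, t) ↦ (R₀ y, -t)`. [folklore] -/
theorem rotE_consCLE (y : 𝔼 n) (t : ℝ) : rotE hn (consCLE n (y, t)) = consCLE n (modelReflection hn y, -t) := by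
  simp [rotE]

/-- The rotation in terms of the tail and the `0`-th coordinate. [folklore] -/
theorem rotE_apply (u : 𝔼 (n + 1)) : rotE hn u = consCLE n (modelReflection hn (tail n u), -u 0) := by
  conv_lhs => rw [← consCLE_tail n u]
  exact rotE_consCLE hn _ _

/-- The rotation is an involution. [folklore] -/
theorem rotE_rotE (u : 𝔼 (n + 1)) : rotE hn (rotE hn u) = u := by
  rw [rotE_apply hn u, rotE_consCLE, modelReflection_modelReflection, neg_neg, consCLE_tail]

/-- The rotation preserves the norm. [folklore] -/
theorem norm_rotE (u : 𝔼 (n + 1)) : ‖rotE hn u‖ = ‖u‖ := by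
  have h1 : ‖rotE hn u‖ ^ 2 = ‖u‖ ^ 2 := by
    rw [rotE_apply hn u, norm_consCLE_sq, norm_modelReflection]
    conv_rhs => rw [← consCLE_tail n u, norm_consCLE_sq]
    ring
  nlinarith [norm_nonneg (rotE hn u), norm_nonneg u]

/-- The rotation preserves Milnor's quadratic form of index `1`. [cite: MilnorHCobordism1965, Def. 3.1] -/
theorem milnorQuadratic_one_rotE (u : 𝔼 (n + 1)) : milnorQuadratic 1 (rotE hn u) = milnorQuadratic 1 u := by
  rw [rotE_apply hn u, milnorQuadratic_one_consCLE, norm_modelReflection]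
  conv_rhs => rw [← consCLE_tail n u, milnorQuadratic_one_consCLE]
  ring

/-- The scaled unit-ball map commutes with the reflection of the parameter space. [folklore] -/
theorem footRadial_modelReflection (ρ : ℝ) (w : 𝔼 n) :
    footRadial n ρ (modelReflection hn w) = modelReflection hn (footRadial n ρ w) := by
  rw [footRadial, footRadial, OpenPartialHomeomorph.univUnitBall_apply, OpenPartialHomeomorph.univUnitBall_apply, norm_modelReflection,
    smul_comm ρ, ← map_smul, ← map_smul, smul_comm]

/-- **The rotation exchanges the model feet and reflects the parameter**:
`r (footModel s m ρ w) = footModel (-s) m ρ (R₀ w)`. [folklore] -/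
theorem rotE_footModel (s m ρ : ℝ) (w : 𝔼 n) :
    rotE hn (footModel n s m ρ w) = footModel n (-s) m ρ (modelReflection hn w) := by
  rw [footModel, rotE_consCLE, footModel, footRadial_modelReflection, norm_modelReflection]
  congr 2; ring

end OneHandleModel

namespace MorseChartRotate

variable {n : ℕ} (hn : 1 ≤ n)

/-! ### The affine reflection about a centre -/

/-- **The reflection about `c₀` in the first coordinate**, `u ↦ c₀ + r(u - c₀)`. [folklore] -/
def rotAt (c₀ : 𝔼 (n + 1)) (u : 𝔼 (n + 1)) : 𝔼 (n + 1) := c₀ + OneHandleModel.rotE hn (u - c₀)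

variable (c₀ : 𝔼 (n + 1))

/-- The reflection is an involution. [folklore] -/
@[simp] theorem rotAt_rotAt (u : 𝔼 (n + 1)) : rotAt hn c₀ (rotAt hn c₀ u) = u := by
  simp [rotAt, OneHandleModel.rotE_rotE hn]

/-- The reflection fixes the centre. [folklore] -/
@[simp] theorem rotAt_self : rotAt hn c₀ c₀ = c₀ := by simp [rotAt]

/-- The reflection is smooth (affine). [folklore] -/
theorem contDiff_rotAt : ContDiff ℝ ∞ (rotAt hn (n := n) c₀) :=
  contDiff_const.add ((OneHandleModel.rotE hn).contDiff.comp (contDiff_id.sub contDiff_const))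

/-- The reflection is continuous. [folklore] -/
theorem continuous_rotAt : Continuous (rotAt hn (n := n) c₀) := (contDiff_rotAt hn c₀).continuous

/-- The reflection preserves distances to the centre. [folklore] -/
theorem norm_rotAt_sub (u : 𝔼 (n + 1)) : ‖rotAt hn c₀ u - c₀‖ = ‖u - c₀‖ := by
  show ‖c₀ + OneHandleModel.rotE hn (u - c₀) - c₀‖ = ‖u - c₀‖
  rw [add_sub_cancel_left, OneHandleModel.norm_rotE hn]

/-- The reflection maps balls about the centre to themselves. [folklore] -/
theorem rotAt_mem_ball {R₀ : ℝ} {u : 𝔼 (n + 1)} (hu : u ∈ ball c₀ R₀) : rotAt hn c₀ u ∈ ball c₀ R₀ := by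
  rw [mem_ball, dist_eq_norm] at hu ⊢; rwa [norm_rotAt_sub hn]

/-- Differences of reflected points are reflected differences. [folklore] -/
theorem rotAt_sub_rotAt (u v : 𝔼 (n + 1)) :
    rotAt hn c₀ u - rotAt hn c₀ v = OneHandleModel.rotE hn (u - v) := by
  simp only [rotAt, add_sub_add_left_eq_sub, ← map_sub, sub_sub_sub_cancel_right]

/-- The rotation sends `c₀ + footModel s m ρ w` to `c₀ + footModel (-s) m ρ (R₀ w)`. [folklore] -/
theorem rotAt_add_footModel (s m ρ : ℝ) (w : 𝔼 n) :
    rotAt hn c₀ (c₀ + footModel n s m ρ w) = c₀ + footModel n (-s) m ρ (modelReflection hn w) := by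
  simp [rotAt, OneHandleModel.rotE_footModel hn]

/-! ### The reflected chart -/

variable {M : Type u} [TopologicalSpace M] (φ : OpenPartialHomeomorph M (ℍ (n + 1))) (p : M) (R₀ : ℝ)

/-- The reflected chart as a function, `I⁻¹ ∘ rotAt hn (φ̂ p) ∘ φ̂`. [folklore] -/
def rcFun (q : M) : ℍ (n + 1) :=
  (𝓡∂ (n + 1)).symm (rotAt hn (φ.extend (𝓡∂ (n + 1)) p) (φ.extend (𝓡∂ (n + 1)) q))

/-- The inverse of the reflected chart as a function, `φ̂⁻¹ ∘ rotAt hn (φ̂ p) ∘ I`. [folklore] -/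
def rcInv (x : ℍ (n + 1)) : M :=
  (φ.extend (𝓡∂ (n + 1))).symm (rotAt hn (φ.extend (𝓡∂ (n + 1)) p) ((𝓡∂ (n + 1)) x))

/-- `I ∘ rcFun hn = rotAt hn ∘ φ̂` on the chart ball. [folklore] -/
theorem apply_rcFun (hball : closedBall (φ.extend (𝓡∂ (n + 1)) p) R₀ ⊆ (φ.extend (𝓡∂ (n + 1))).target)
    {q : M} (hq : φ.extend (𝓡∂ (n + 1)) q ∈ ball (φ.extend (𝓡∂ (n + 1)) p) R₀) :
    (𝓡∂ (n + 1)) (rcFun hn φ p q) = rotAt hn (φ.extend (𝓡∂ (n + 1)) p) (φ.extend (𝓡∂ (n + 1)) q) :=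
  (𝓡∂ (n + 1)).right_inv (MorseChartReflect.ball_subset_range φ p R₀ hball (rotAt_mem_ball hn _ hq))

/-- `φ̂ ∘ rcInv hn = rotAt hn ∘ I` on the chart ball, and `rcInv hn` lands in the source. [folklore] -/
theorem apply_rcInv (hball : closedBall (φ.extend (𝓡∂ (n + 1)) p) R₀ ⊆ (φ.extend (𝓡∂ (n + 1))).target)
    {x : ℍ (n + 1)} (hx : (𝓡∂ (n + 1)) x ∈ ball (φ.extend (𝓡∂ (n + 1)) p) R₀) :
    rcInv hn φ p x ∈ φ.source ∧
      φ.extend (𝓡∂ (n + 1)) (rcInv hn φ p x) = rotAt hn (φ.extend (𝓡∂ (n + 1)) p) ((𝓡∂ (n + 1)) x) := by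
  have htgt : rotAt hn (φ.extend (𝓡∂ (n + 1)) p) ((𝓡∂ (n + 1)) x) ∈ (φ.extend (𝓡∂ (n + 1))).target :=
    hball (ball_subset_closedBall (rotAt_mem_ball hn _ hx))
  refine ⟨?_, (φ.extend (𝓡∂ (n + 1))).right_inv htgt⟩
  have := (φ.extend (𝓡∂ (n + 1))).map_target htgt
  rwa [φ.extend_source] at this

/-- **The reflected chart** `φᵣ = I⁻¹ ∘ rotAt hn (φ̂ p) ∘ φ̂` on `φ.source ∩ φ̂⁻¹ B(φ̂ p, R₀)`.
[cite: Kosinski1993, VI (6.6)] -/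
def rotateChart (hball : closedBall (φ.extend (𝓡∂ (n + 1)) p) R₀ ⊆ (φ.extend (𝓡∂ (n + 1))).target) :
    OpenPartialHomeomorph M (ℍ (n + 1)) where
  toFun := rcFun hn φ p
  invFun := rcInv hn φ p
  source := φ.source ∩ φ.extend (𝓡∂ (n + 1)) ⁻¹' ball (φ.extend (𝓡∂ (n + 1)) p) R₀
  target := (𝓡∂ (n + 1)) ⁻¹' ball (φ.extend (𝓡∂ (n + 1)) p) R₀
  map_source' := by
    rintro q ⟨_, hqb⟩
    show (𝓡∂ (n + 1)) (rcFun hn φ p q) ∈ ball (φ.extend (𝓡∂ (n + 1)) p) R₀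
    rw [apply_rcFun hn φ p R₀ hball hqb]
    exact rotAt_mem_ball hn _ hqb
  map_target' := by
    intro x hx
    have hx' : (𝓡∂ (n + 1)) x ∈ ball (φ.extend (𝓡∂ (n + 1)) p) R₀ := hx
    obtain ⟨hsrc, happ⟩ := apply_rcInv hn φ p R₀ hball hx'
    refine ⟨hsrc, ?_⟩
    show φ.extend (𝓡∂ (n + 1)) (rcInv hn φ p x) ∈ ball (φ.extend (𝓡∂ (n + 1)) p) R₀
    rw [happ]
    exact rotAt_mem_ball hn _ hx'
  left_inv' := by
    rintro q ⟨hq, hqb⟩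
    show (φ.extend (𝓡∂ (n + 1))).symm (rotAt hn (φ.extend (𝓡∂ (n + 1)) p) ((𝓡∂ (n + 1)) (rcFun hn φ p q))) = q
    rw [apply_rcFun hn φ p R₀ hball hqb, rotAt_rotAt hn]
    exact (φ.extend (𝓡∂ (n + 1))).left_inv (show q ∈ (φ.extend (𝓡∂ (n + 1))).source by
      rwa [φ.extend_source])
  right_inv' := by
    intro x hx
    have hx' : (𝓡∂ (n + 1)) x ∈ ball (φ.extend (𝓡∂ (n + 1)) p) R₀ := hx
    obtain ⟨_, happ⟩ := apply_rcInv hn φ p R₀ hball hx'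
    show (𝓡∂ (n + 1)).symm (rotAt hn (φ.extend (𝓡∂ (n + 1)) p) (φ.extend (𝓡∂ (n + 1)) (rcInv hn φ p x))) = x
    rw [happ, rotAt_rotAt hn, (𝓡∂ (n + 1)).left_inv]
  open_source := by
    have hc : ContinuousOn (φ.extend (𝓡∂ (n + 1))) φ.source := by
      have h := φ.continuousOn_extend (I := 𝓡∂ (n + 1)); rwa [φ.extend_source] at h
    exact hc.isOpen_inter_preimage φ.open_source isOpen_ball
  open_target := isOpen_ball.preimage (𝓡∂ (n + 1)).continuous
  continuousOn_toFun := by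
    have hc : ContinuousOn (φ.extend (𝓡∂ (n + 1))) φ.source := by
      have h := φ.continuousOn_extend (I := 𝓡∂ (n + 1)); rwa [φ.extend_source] at h
    exact (𝓡∂ (n + 1)).continuous_symm.comp_continuousOn
      ((continuous_rotAt hn _).comp_continuousOn (hc.mono inter_subset_left))
  continuousOn_invFun := by
    have h1 : Continuous fun x : ℍ (n + 1) => rotAt hn (φ.extend (𝓡∂ (n + 1)) p) ((𝓡∂ (n + 1)) x) :=
      (continuous_rotAt hn _).comp (𝓡∂ (n + 1)).continuous
    have h2 : ContinuousOn (φ.extend (𝓡∂ (n + 1))).symm (φ.extend (𝓡∂ (n + 1))).target :=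
      φ.continuousOn_extend_symm (I := 𝓡∂ (n + 1))
    refine h2.comp h1.continuousOn fun x hx => ?_
    exact hball (ball_subset_closedBall (rotAt_mem_ball hn _ hx))

variable (hball : closedBall (φ.extend (𝓡∂ (n + 1)) p) R₀ ⊆ (φ.extend (𝓡∂ (n + 1))).target)

/-- The source of the reflected chart. [folklore] -/
@[simp] theorem rotateChart_source :
    (rotateChart hn φ p R₀ hball).source = φ.source ∩ φ.extend (𝓡∂ (n + 1)) ⁻¹' ball (φ.extend (𝓡∂ (n + 1)) p) R₀ :=
  rfl

/-- The target of the reflected chart. [folklore] -/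
@[simp] theorem rotateChart_target :
    (rotateChart hn φ p R₀ hball).target = (𝓡∂ (n + 1)) ⁻¹' ball (φ.extend (𝓡∂ (n + 1)) p) R₀ :=
  rfl

/-- The reflected chart as a function. [folklore] -/
theorem rotateChart_apply (q : M) : rotateChart hn φ p R₀ hball q = rcFun hn φ p q := rfl

/-- The inverse of the reflected chart as a function. [folklore] -/
theorem rotateChart_symm_apply (x : ℍ (n + 1)) : (rotateChart hn φ p R₀ hball).symm x = rcInv hn φ p x := rfl

/-- **The extended reflected chart is the reflected extended chart** on its source.
[folklore] -/
theorem extend_rotateChart {q : M} (hq : q ∈ (rotateChart hn φ p R₀ hball).source) :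
    (rotateChart hn φ p R₀ hball).extend (𝓡∂ (n + 1)) q =
      rotAt hn (φ.extend (𝓡∂ (n + 1)) p) (φ.extend (𝓡∂ (n + 1)) q) := by
  rw [OpenPartialHomeomorph.extend_coe, comp_apply, rotateChart_apply hn]
  exact apply_rcFun hn φ p R₀ hball hq.2

/-- The centre lies in the source of the reflected chart (`0 < R₀`). [folklore] -/
theorem mem_rotateChart_source (hp : p ∈ φ.source) (hR₀ : 0 < R₀) : p ∈ (rotateChart hn φ p R₀ hball).source :=
  ⟨hp, mem_ball_self hR₀⟩

/-- **The reflected chart has the same centre.** [folklore] -/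
theorem extend_rotateChart_self (hp : p ∈ φ.source) (hR₀ : 0 < R₀) :
    (rotateChart hn φ p R₀ hball).extend (𝓡∂ (n + 1)) p = φ.extend (𝓡∂ (n + 1)) p := by
  rw [extend_rotateChart hn φ p R₀ hball (mem_rotateChart_source hn φ p R₀ hball hp hR₀), rotAt_self hn]

/-- **Milnor's normal form of index `1` is preserved by the reflection.**
[cite: MilnorHCobordism1965, Def. 3.1] -/
theorem apply_eq_rotateChart {f : M → ℝ} (hp : p ∈ φ.source) (hR₀ : 0 < R₀)
    (hfq : ∀ q ∈ φ.source, f q = f p + milnorQuadratic 1 (φ.extend (𝓡∂ (n + 1)) q - φ.extend (𝓡∂ (n + 1)) p))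
    {q : M} (hq : q ∈ (rotateChart hn φ p R₀ hball).source) :
    f q = f p + milnorQuadratic 1 ((rotateChart hn φ p R₀ hball).extend (𝓡∂ (n + 1)) q -
      (rotateChart hn φ p R₀ hball).extend (𝓡∂ (n + 1)) p) := by
  rw [extend_rotateChart hn φ p R₀ hball hq, extend_rotateChart hn φ p R₀ hball
    (mem_rotateChart_source hn φ p R₀ hball hp hR₀), rotAt_sub_rotAt hn,
    OneHandleModel.milnorQuadratic_one_rotE hn]
  exact hfq q hq.1

/-- **The reflected chart lies in the maximal atlas** (it and its inverse are smooth: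
composites of `φ̂`, the affine reflection and the model maps). [cite: LeeSmoothManifolds2013, Prop. 1.17] -/
theorem rotateChart_mem_maximalAtlas [ChartedSpace (ℍ (n + 1)) M] [IsManifold (𝓡∂ (n + 1)) ∞ M]
    (hφ : φ ∈ IsManifold.maximalAtlas (𝓡∂ (n + 1)) ∞ M) :
    rotateChart hn φ p R₀ hball ∈ IsManifold.maximalAtlas (𝓡∂ (n + 1)) ∞ M := by
  set c₀ := φ.extend (𝓡∂ (n + 1)) p with hc₀
  apply OpenPartialHomeomorph.mem_maximalAtlas_of_contMDiffOn
  · -- `φᵣ = I⁻¹ ∘ rotAt hn ∘ φ̂` on the source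
    have h1 : ContMDiffOn (𝓡∂ (n + 1)) 𝓘(ℝ, 𝔼 (n + 1)) ∞ (φ.extend (𝓡∂ (n + 1))) φ.source :=
      OpenPartialHomeomorph.contMDiffOn_extend hφ
    have h2 : ContMDiffOn (𝓡∂ (n + 1)) 𝓘(ℝ, 𝔼 (n + 1)) ∞
        (fun q => rotAt hn c₀ (φ.extend (𝓡∂ (n + 1)) q)) (rotateChart hn φ p R₀ hball).source :=
      ((contDiff_rotAt hn c₀).contMDiff.comp_contMDiffOn h1).mono inter_subset_left
    have h3 := (𝓡∂ (n + 1)).contMDiffOn_symm (n := ∞)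
    exact h3.comp h2 fun q hq => MorseChartReflect.ball_subset_range φ p R₀ hball (rotAt_mem_ball hn _ hq.2)
  · -- `φᵣ⁻¹ = φ̂⁻¹ ∘ rotAt hn ∘ I = φ⁻¹ ∘ (I⁻¹ ∘ rotAt hn ∘ I)` on the target
    have h1 : ContMDiff (𝓡∂ (n + 1)) 𝓘(ℝ, 𝔼 (n + 1)) ∞ fun x : ℍ (n + 1) => rotAt hn c₀ ((𝓡∂ (n + 1)) x) :=
      (contDiff_rotAt hn c₀).contMDiff.comp (𝓡∂ (n + 1)).contMDiff
    have h2 : ContMDiffOn (𝓡∂ (n + 1)) (𝓡∂ (n + 1)) ∞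
        (fun x : ℍ (n + 1) => (𝓡∂ (n + 1)).symm (rotAt hn c₀ ((𝓡∂ (n + 1)) x)))
        (rotateChart hn φ p R₀ hball).target :=
      ((𝓡∂ (n + 1)).contMDiffOn_symm (n := ∞)).comp h1.contMDiffOn fun x hx =>
        MorseChartReflect.ball_subset_range φ p R₀ hball (rotAt_mem_ball hn _ hx)
    have h3 : ContMDiffOn (𝓡∂ (n + 1)) (𝓡∂ (n + 1)) ∞ φ.symm φ.target :=
      contMDiffOn_symm_of_mem_maximalAtlas hφ
    have h4 := h3.comp h2 fun x hx => by
      have hx' : rotAt hn c₀ ((𝓡∂ (n + 1)) x) ∈ ball c₀ R₀ := rotAt_mem_ball hn _ hx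
      have htgt := hball (ball_subset_closedBall hx')
      rw [φ.extend_target] at htgt
      exact htgt.1
    exact h4.congr fun x _ => rfl

/-- A smaller closed ball lies in the target of the extended reflected chart. [folklore] -/
theorem closedBall_subset_rotateChart_target {R : ℝ} (hR : R < R₀) :
    closedBall (φ.extend (𝓡∂ (n + 1)) p) R ⊆ ((rotateChart hn φ p R₀ hball).extend (𝓡∂ (n + 1))).target := by
  intro u hu
  have hub : u ∈ ball (φ.extend (𝓡∂ (n + 1)) p) R₀ := closedBall_subset_ball hR hu
  have hur : u ∈ range (𝓡∂ (n + 1)) := MorseChartReflect.ball_subset_range φ p R₀ hball hub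
  rw [OpenPartialHomeomorph.extend_target]
  refine ⟨?_, hur⟩
  show (𝓡∂ (n + 1)) ((𝓡∂ (n + 1)).symm u) ∈ ball (φ.extend (𝓡∂ (n + 1)) p) R₀
  rwa [(𝓡∂ (n + 1)).right_inv hur]

/-- **The feet of the reflected chart are the feet of `φ` with the sign exchanged**:
`φ̂ᵣ⁻¹(c₀ + footModel s m ρ w) = φ̂⁻¹(c₀ + footModel (-s) m ρ (R₀ w))` (for foot points in the chart
ball). [cite: Kosinski1993, VI (6.6)] -/
theorem rotateChart_extend_symm_add_footModel {s m ρ : ℝ} {w : 𝔼 n}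
    (hw : φ.extend (𝓡∂ (n + 1)) p + footModel n s m ρ w ∈ ball (φ.extend (𝓡∂ (n + 1)) p) R₀) :
    ((rotateChart hn φ p R₀ hball).extend (𝓡∂ (n + 1))).symm (φ.extend (𝓡∂ (n + 1)) p + footModel n s m ρ w) =
      (φ.extend (𝓡∂ (n + 1))).symm (φ.extend (𝓡∂ (n + 1)) p + footModel n (-s) m ρ (modelReflection hn w)) := by
  rw [OpenPartialHomeomorph.extend_coe_symm, comp_apply, rotateChart_symm_apply hn, rcInv,
    (𝓡∂ (n + 1)).right_inv (MorseChartReflect.ball_subset_range φ p R₀ hball hw), rotAt_add_footModel hn]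

/-- Points of the chart ball lie in the target of the extended reflected chart. [folklore] -/
theorem mem_rotateChart_extend_target {u : 𝔼 (n + 1)} (hu : u ∈ ball (φ.extend (𝓡∂ (n + 1)) p) R₀) :
    u ∈ ((rotateChart hn φ p R₀ hball).extend (𝓡∂ (n + 1))).target := by
  have hur : u ∈ range (𝓡∂ (n + 1)) := MorseChartReflect.ball_subset_range φ p R₀ hball hu
  rw [OpenPartialHomeomorph.extend_target]
  refine ⟨?_, hur⟩
  show (𝓡∂ (n + 1)) ((𝓡∂ (n + 1)).symm u) ∈ ball (φ.extend (𝓡∂ (n + 1)) p) R₀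
  rwa [(𝓡∂ (n + 1)).right_inv hur]

/-- **The feet of a handle chart built on the reflected chart** are the feet, with the sign
exchanged, of a handle chart built on `φ`, whenever the two handle charts extend to `φ̂ᵣ`, `φ̂`
with smaller sources (as the charts produced by `exists_handleSide_data` do) and the two foot
points lie in the chart balls. [cite: Kosinski1993, VI (6.6)] -/
theorem foot_eq_foot_neg [ChartedSpace (ℍ (n + 1)) M] {f : M → ℝ} {X X' : Π x : M, TangentSpace (𝓡∂ (n + 1)) x}
    (D : HandleChart (𝓡∂ (n + 1)) f X p) (D' : HandleChart (𝓡∂ (n + 1)) f X' p)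
    (hD : ∀ q, D.chart.extend (𝓡∂ (n + 1)) q = (rotateChart hn φ p R₀ hball).extend (𝓡∂ (n + 1)) q)
    (hDs : D.chart.source ⊆ (rotateChart hn φ p R₀ hball).source)
    (hD' : ∀ q, D'.chart.extend (𝓡∂ (n + 1)) q = φ.extend (𝓡∂ (n + 1)) q)
    (hD's : D'.chart.source ⊆ φ.source)
    (hp : p ∈ φ.source) (hR₀ : 0 < R₀) {s m ρ : ℝ} {w : 𝔼 n}
    (hw : φ.extend (𝓡∂ (n + 1)) p + footModel n s m ρ w ∈ ball (φ.extend (𝓡∂ (n + 1)) p) R₀)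
    (hw' : φ.extend (𝓡∂ (n + 1)) p + footModel n (-s) m ρ (modelReflection hn w) ∈ ball (φ.extend (𝓡∂ (n + 1)) p) R₀)
    (hwD : φ.extend (𝓡∂ (n + 1)) p + footModel n s m ρ w ∈ (D.chart.extend (𝓡∂ (n + 1))).target)
    (hwD' : φ.extend (𝓡∂ (n + 1)) p + footModel n (-s) m ρ (modelReflection hn w) ∈
      (D'.chart.extend (𝓡∂ (n + 1))).target) :
    D.foot s m ρ w = D'.foot (-s) m ρ (modelReflection hn w) := by
  have hc : D.chart.extend (𝓡∂ (n + 1)) p = φ.extend (𝓡∂ (n + 1)) p := by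
    rw [hD, extend_rotateChart_self hn φ p R₀ hball hp hR₀]
  have hc' : D'.chart.extend (𝓡∂ (n + 1)) p = φ.extend (𝓡∂ (n + 1)) p := hD' p
  have hs₁ : (D.chart.extend (𝓡∂ (n + 1))).source ⊆ ((rotateChart hn φ p R₀ hball).extend (𝓡∂ (n + 1))).source := by
    rw [OpenPartialHomeomorph.extend_source, OpenPartialHomeomorph.extend_source]; exact hDs
  have hs₂ : (D'.chart.extend (𝓡∂ (n + 1))).source ⊆ (φ.extend (𝓡∂ (n + 1))).source := by
    rw [OpenPartialHomeomorph.extend_source, OpenPartialHomeomorph.extend_source]; exact hD's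
  show (D.chart.extend (𝓡∂ (n + 1))).symm (D.chart.extend (𝓡∂ (n + 1)) p + footModel n s m ρ w) =
    (D'.chart.extend (𝓡∂ (n + 1))).symm
      (D'.chart.extend (𝓡∂ (n + 1)) p + footModel n (-s) m ρ (modelReflection hn w))
  rw [hc, hc', MorseChartReflect.symm_eq_symm_of_forall_eq hD hs₁ hwD (mem_rotateChart_extend_target hn φ p R₀ hball hw),
    rotateChart_extend_symm_add_footModel hn φ p R₀ hball hw,
    MorseChartReflect.symm_eq_symm_of_forall_eq hD' hs₂ hwD' (hball (ball_subset_closedBall hw'))]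

end MorseChartRotate

end Literature.Topology.FourManifolds
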